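import Literature.Probability.Percolation.AltFourArmInterface
import HarnessLib

/-!
# Crossing stretches of an interface loop in a hexagonal annulus, and the cluster-boundary loop

Topic: Probability / Percolation. Bookkeeping for the interface loops (`IsSiteInterfaceLoop`,
`CLE6.lean`: cycles of the hexagonal lattice with an open site on the left and a closed site on
the right of every step) of the **annulus configuration** `annConfig n N ω` — `ω` on the closed
annulus `{n ≤ |·|_𝕋 ≤ N}`, open inside `Λ̊_n`, closed off `Λ_N` — which is the configuration
through which four-arm events of the annulus are read off crossing interfaces
(`AltFourArmInterface.lean`; S. Smirnov, W. Werner, Math. Res. Lett. 8 (2001), §4, Remark 6 and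
(15): `j` alternating arms ⇔ `j` crossings of the annulus by the exploration interface;
M. Aizenman, A. Burchard, Duke Math. J. 99 (1999), App. A: the crossing segments of a curve cut an
annulus into sectors). A step of such a loop is **low** when it touches `Λ̊_n` and **high** when
it touches `(Λ_N)ᶜ`; an **outward stretch** is a low step, then steps touching neither, then a
high step (an inward stretch, the same backwards): between the low and the high step the loop
crosses the annulus. We prove:

* `annConfig` and its elementary properties (finite, agrees with `ω` on the annulus);
* periodic step predicates `LowP`, `HighP` (indices mod the length), `IsOutStretch`,
  `IsInStretch`, the finite sets `outStarts`, `inStarts` of their starting steps and the counts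
  `outCount`, `inCount`; a stretch is at most one period long, its end is determined by its start,
  and it exists as soon as the loop has a low and a high step (`exists_isOutStretch`,
  `exists_isInStretch`, `outStarts_nonempty`, `inStarts_nonempty`);
* **`IsKCLoop n N ω w`** — the interface loop of `annConfig n N ω` normalised by its winding
  numbers (`1` about the sites of `Λ̊_n`, `0` about the sites off `Λ_N`): the common boundary of
  the open cluster of the inner ball and the closed cluster of the exterior. It exists through any
  edge from a site joined to the ball by open sites to a site joined to the exterior by closed
  sites (`exists_isKCLoop`), and every such edge is a step of every such loop
  (`IsKCLoop.exists_step`); transport of the winding number along open / closed paths.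

Everything is proved; no named facts are introduced.

## References

* S. Smirnov, W. Werner, Math. Res. Lett. 8 (2001) 729–744, §4 [SmirnovWernerMRL2001].
* M. Aizenman, A. Burchard, Duke Math. J. 99 (1999), Appendix A [AizenmanBurchardDuke1999].
* F. Camia, C. M. Newman, Comm. Math. Phys. 268 (2006), §4 [CamiaNewman2006].

Tree: `IsSiteInterfaceLoop.lv/rv`, `exists_isSiteInterfaceLoop_of_adj`, `loopWind` and its
transport rules (`SiteInterfaceWinding.lean`, `ArmEventsInterface.lean`), `exists_stretch_up`
(`AltFourArmInterface.lean`), `triNorm` arithmetic.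
-/

noncomputable section

open Set Metric Complex

namespace Literature.Probability.Percolation

open LatticeModels

/-! ### The annulus configuration -/

/-- **The annulus configuration**: open inside `Λ̊_n`, equal to `ω` on `{n ≤ |·|_𝕋 ≤ N}`, closed
off `Λ_N` (the configuration `ω₁` of `exists_four_interfaceWalks_of_mem_altFourArm`).
[cite: SmirnovWernerMRL2001, §4 Remark 6] -/
def annConfig (n N : ℕ) (ω : SiteConfig (Site 2)) : SiteConfig (Site 2) :=
  {v | triNorm v < n ∨ (v ∈ ω ∧ triNorm v ≤ N)}

section AnnConfig

variable {n N : ℕ} {ω : SiteConfig (Site 2)}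

/-- Sites of the open inner ball are open. [folklore] -/
theorem mem_annConfig_of_lt {v : Site 2} (hv : triNorm v < n) : v ∈ annConfig n N ω := Or.inl hv

/-- Sites off `Λ_N` are closed (`n ≤ N`). [folklore] -/
theorem not_mem_annConfig_of_lt (hnN : n ≤ N) {v : Site 2} (hv : (N : ℤ) < triNorm v) : v ∉ annConfig n N ω := by
  rintro (h | h) <;> omega

/-- On the closed annulus the configuration is `ω`. [folklore] -/
theorem mem_annConfig_iff {v : Site 2} (h1 : (n : ℤ) ≤ triNorm v) (h2 : triNorm v ≤ N) :
    v ∈ annConfig n N ω ↔ v ∈ ω :=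
  ⟨fun h ↦ h.elim (fun h ↦ absurd h1 (not_le.2 h)) fun h ↦ h.1, fun h ↦ Or.inr ⟨h, h2⟩⟩

/-- A closed site has norm `≥ n`. [folklore] -/
theorem le_triNorm_of_not_mem_annConfig {v : Site 2} (hv : v ∉ annConfig n N ω) : (n : ℤ) ≤ triNorm v := by
  by_contra h; exact hv (mem_annConfig_of_lt (by omega))

/-- An open site has norm `≤ N`. [folklore] -/
theorem triNorm_le_of_mem_annConfig {v : Site 2} (hn : n ≤ N) (hv : v ∈ annConfig n N ω) : triNorm v ≤ N := by
  rcases hv with h | h <;> omega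

/-- The annulus configuration has finitely many open sites (all in `Λ_N`). [folklore] -/
theorem annConfig_finite (hn : n ≤ N) : (annConfig n N ω).Finite :=
  (triBall N).finite_toSet.subset fun _ hv ↦ Finset.mem_coe.2 (mem_triBall_iff.2 (triNorm_le_of_mem_annConfig hn hv))

end AnnConfig

/-! ### Low and high steps, periodic indices -/

section Steps

variable {χ : SiteConfig (Site 2)} {f₀ : HexVertex} {w : hexGraph.Walk f₀ f₀} (hw : IsSiteInterfaceLoop χ w)

/-- An interface loop has at least three steps. [folklore] -/
theorem IsSiteInterfaceLoop.length_pos (hw : IsSiteInterfaceLoop χ w) : 0 < w.length := by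
  have := hw.isCycle.three_le_length; omega

/-- **Low step** `i` (periodic index): the crossed edge of step `i mod length` has a site in the
open inner ball `Λ̊_n`. [cite: AizenmanBurchardDuke1999, Appendix A] -/
def IsSiteInterfaceLoop.LowP (n : ℕ) (i : ℕ) : Prop :=
  triNorm (hw.lv (i % w.length)) < n ∨ triNorm (hw.rv (i % w.length)) < n

/-- **High step** `i` (periodic index): the crossed edge of step `i mod length` has a site off
`Λ_N`. [cite: AizenmanBurchardDuke1999, Appendix A] -/
def IsSiteInterfaceLoop.HighP (N : ℕ) (i : ℕ) : Prop :=
  (N : ℤ) < triNorm (hw.lv (i % w.length)) ∨ (N : ℤ) < triNorm (hw.rv (i % w.length))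

variable {hw}

/-- The predicates are periodic. [folklore] -/
theorem IsSiteInterfaceLoop.lowP_add_length {n i : ℕ} : hw.LowP n (i + w.length) ↔ hw.LowP n i := by
  simp only [IsSiteInterfaceLoop.LowP, Nat.add_mod_right]

/-- The predicates are periodic. [folklore] -/
theorem IsSiteInterfaceLoop.highP_add_length {N i : ℕ} : hw.HighP N (i + w.length) ↔ hw.HighP N i := by
  simp only [IsSiteInterfaceLoop.HighP, Nat.add_mod_right]

/-- The predicates are periodic (general multiple). [folklore] -/
theorem IsSiteInterfaceLoop.lowP_add_mul_length {n i k : ℕ} : hw.LowP n (i + k * w.length) ↔ hw.LowP n i := by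
  simp only [IsSiteInterfaceLoop.LowP, Nat.add_mul_mod_self_right]

/-- The predicates are periodic (general multiple). [folklore] -/
theorem IsSiteInterfaceLoop.highP_add_mul_length {N i k : ℕ} : hw.HighP N (i + k * w.length) ↔ hw.HighP N i := by
  simp only [IsSiteInterfaceLoop.HighP, Nat.add_mul_mod_self_right]

/-- Periodic predicates only depend on the residue. [folklore] -/
theorem IsSiteInterfaceLoop.lowP_mod {n i : ℕ} : hw.LowP n (i % w.length) ↔ hw.LowP n i := by
  simp only [IsSiteInterfaceLoop.LowP, Nat.mod_mod]

/-- Periodic predicates only depend on the residue. [folklore] -/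
theorem IsSiteInterfaceLoop.highP_mod {N i : ℕ} : hw.HighP N (i % w.length) ↔ hw.HighP N i := by
  simp only [IsSiteInterfaceLoop.HighP, Nat.mod_mod]

/-- The two sites of a step have graph norms differing by at most one. [folklore] -/
theorem IsSiteInterfaceLoop.triNorm_lv_rv_mod (i : ℕ) :
    triNorm (hw.rv (i % w.length)) ≤ triNorm (hw.lv (i % w.length)) + 1 ∧
      triNorm (hw.lv (i % w.length)) ≤ triNorm (hw.rv (i % w.length)) + 1 := by
  have hi : i % w.length < w.length := Nat.mod_lt _ hw.length_pos
  have hadj := hw.adj_lv_rv hi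
  exact ⟨triNorm_le_triNorm_add_one_of_adj hadj, triNorm_le_triNorm_add_one_of_adj hadj.symm⟩

/-- **A step is not both low and high** (for `n ≤ N`). [folklore] -/
theorem IsSiteInterfaceLoop.not_lowP_of_highP {n N : ℕ} (hnN : n ≤ N) {i : ℕ} (h : hw.HighP N i) :
    ¬ hw.LowP n i := by
  intro h'
  have := hw.triNorm_lv_rv_mod i
  have := triNorm_nonneg (hw.lv (i % w.length)); have := triNorm_nonneg (hw.rv (i % w.length))
  unfold IsSiteInterfaceLoop.HighP at h; unfold IsSiteInterfaceLoop.LowP at h'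
  omega

/-! ### Stretches -/

/-- **Outward stretch** from step `j` to step `k` (integer indices read periodically): step `j`
is low, step `k` is high, `j < k`, and the steps strictly between touch neither boundary region —
between them the loop crosses the annulus outward. [cite: AizenmanBurchardDuke1999, Appendix A] -/
def IsSiteInterfaceLoop.IsOutStretch (hw : IsSiteInterfaceLoop χ w) (n N : ℕ) (j k : ℕ) : Prop :=
  hw.LowP n j ∧ hw.HighP N k ∧ j < k ∧ ∀ m, j < m → m < k → ¬ hw.LowP n m ∧ ¬ hw.HighP N m

/-- **Inward stretch** from step `j` to step `k`: step `j` is high, step `k` is low, `j < k`, and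
the steps strictly between touch neither boundary region. [cite: AizenmanBurchardDuke1999, Appendix A] -/
def IsSiteInterfaceLoop.IsInStretch (hw : IsSiteInterfaceLoop χ w) (n N : ℕ) (j k : ℕ) : Prop :=
  hw.HighP N j ∧ hw.LowP n k ∧ j < k ∧ ∀ m, j < m → m < k → ¬ hw.LowP n m ∧ ¬ hw.HighP N m

/-- **A stretch is at most one period long.** [folklore] -/
theorem IsSiteInterfaceLoop.IsOutStretch.sub_le {n N j k : ℕ} (h : hw.IsOutStretch n N j k) : k ≤ j + w.length := by
  by_contra hlt
  push Not at hlt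
  have := (h.2.2.2 (j + w.length) (by have := hw.length_pos; omega) hlt).1
  exact this (IsSiteInterfaceLoop.lowP_add_length.2 h.1)

/-- **A stretch is at most one period long.** [folklore] -/
theorem IsSiteInterfaceLoop.IsInStretch.sub_le {n N j k : ℕ} (h : hw.IsInStretch n N j k) : k ≤ j + w.length := by
  by_contra hlt
  push Not at hlt
  have := (h.2.2.2 (j + w.length) (by have := hw.length_pos; omega) hlt).2
  exact this (IsSiteInterfaceLoop.highP_add_length.2 h.1)

/-- Shifting by a period preserves outward stretches. [folklore] -/
theorem IsSiteInterfaceLoop.IsOutStretch.add_length {n N j k : ℕ} (h : hw.IsOutStretch n N j k) :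
    hw.IsOutStretch n N (j + w.length) (k + w.length) := by
  refine ⟨IsSiteInterfaceLoop.lowP_add_length.2 h.1, IsSiteInterfaceLoop.highP_add_length.2 h.2.1,
    by have := h.2.2.1; omega, fun m h1 h2 ↦ ?_⟩
  have := h.2.2.2 (m - w.length) (by omega) (by omega)
  rwa [← IsSiteInterfaceLoop.lowP_add_length (i := m - w.length), ← IsSiteInterfaceLoop.highP_add_length (i := m - w.length),
    Nat.sub_add_cancel (by omega)] at this

/-- Shifting by a period preserves inward stretches. [folklore] -/
theorem IsSiteInterfaceLoop.IsInStretch.add_length {n N j k : ℕ} (h : hw.IsInStretch n N j k) :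
    hw.IsInStretch n N (j + w.length) (k + w.length) := by
  refine ⟨IsSiteInterfaceLoop.highP_add_length.2 h.1, IsSiteInterfaceLoop.lowP_add_length.2 h.2.1,
    by have := h.2.2.1; omega, fun m h1 h2 ↦ ?_⟩
  have := h.2.2.2 (m - w.length) (by omega) (by omega)
  rwa [← IsSiteInterfaceLoop.lowP_add_length (i := m - w.length), ← IsSiteInterfaceLoop.highP_add_length (i := m - w.length),
    Nat.sub_add_cancel (by omega)] at this

/-- Shifting by any multiple of the period preserves outward stretches. [folklore] -/
theorem IsSiteInterfaceLoop.IsOutStretch.add_mul_length {n N j k : ℕ} (h : hw.IsOutStretch n N j k) (c : ℕ) :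
    hw.IsOutStretch n N (j + c * w.length) (k + c * w.length) := by
  induction c with
  | zero => simpa using h
  | succ c ih =>
    have := ih.add_length
    simp only [Nat.succ_mul, ← Nat.add_assoc] at this ⊢
    exact this

/-- Shifting by any multiple of the period preserves inward stretches. [folklore] -/
theorem IsSiteInterfaceLoop.IsInStretch.add_mul_length {n N j k : ℕ} (h : hw.IsInStretch n N j k) (c : ℕ) :
    hw.IsInStretch n N (j + c * w.length) (k + c * w.length) := by
  induction c with
  | zero => simpa using h
  | succ c ih =>
    have := ih.add_length
    simp only [Nat.succ_mul, ← Nat.add_assoc] at this ⊢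
    exact this

/-- Shifting down by a period preserves outward stretches. [folklore] -/
theorem IsSiteInterfaceLoop.IsOutStretch.sub_length {n N j k : ℕ} (h : hw.IsOutStretch n N j k) (hj : w.length ≤ j) :
    hw.IsOutStretch n N (j - w.length) (k - w.length) := by
  have hjk : j < k := h.2.2.1
  have hk : w.length ≤ k := le_trans hj hjk.le
  refine ⟨?_, ?_, by omega, fun m h1 h2 ↦ ?_⟩
  · rw [← IsSiteInterfaceLoop.lowP_add_length, Nat.sub_add_cancel hj]; exact h.1
  · rw [← IsSiteInterfaceLoop.highP_add_length, Nat.sub_add_cancel hk]; exact h.2.1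
  · have := h.2.2.2 (m + w.length) (by omega) (by omega)
    rwa [IsSiteInterfaceLoop.lowP_add_length, IsSiteInterfaceLoop.highP_add_length] at this

/-- Shifting down by a period preserves inward stretches. [folklore] -/
theorem IsSiteInterfaceLoop.IsInStretch.sub_length {n N j k : ℕ} (h : hw.IsInStretch n N j k) (hj : w.length ≤ j) :
    hw.IsInStretch n N (j - w.length) (k - w.length) := by
  have hjk : j < k := h.2.2.1
  have hk : w.length ≤ k := le_trans hj hjk.le
  refine ⟨?_, ?_, by omega, fun m h1 h2 ↦ ?_⟩
  · rw [← IsSiteInterfaceLoop.highP_add_length, Nat.sub_add_cancel hj]; exact h.1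
  · rw [← IsSiteInterfaceLoop.lowP_add_length, Nat.sub_add_cancel hk]; exact h.2.1
  · have := h.2.2.2 (m + w.length) (by omega) (by omega)
    rwa [IsSiteInterfaceLoop.lowP_add_length, IsSiteInterfaceLoop.highP_add_length] at this

/-- **The end of an outward stretch is determined by its start.** [folklore] -/
theorem IsSiteInterfaceLoop.IsOutStretch.end_unique {n N : ℕ} {j k k' : ℕ}
    (h : hw.IsOutStretch n N j k) (h' : hw.IsOutStretch n N j k') : k = k' := by
  rcases lt_trichotomy k k' with hlt | heq | hgt
  · exact absurd h.2.1 (h'.2.2.2 k h.2.2.1 hlt).2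
  · exact heq
  · exact absurd h'.2.1 (h.2.2.2 k' h'.2.2.1 hgt).2

/-- **The end of an inward stretch is determined by its start.** [folklore] -/
theorem IsSiteInterfaceLoop.IsInStretch.end_unique {n N : ℕ} {j k k' : ℕ}
    (h : hw.IsInStretch n N j k) (h' : hw.IsInStretch n N j k') : k = k' := by
  rcases lt_trichotomy k k' with hlt | heq | hgt
  · exact absurd h.2.1 (h'.2.2.2 k h.2.2.1 hlt).1
  · exact heq
  · exact absurd h'.2.1 (h.2.2.2 k' h'.2.2.1 hgt).1

/-- **The start of an outward stretch is determined by its end.** [folklore] -/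
theorem IsSiteInterfaceLoop.IsOutStretch.start_unique {n N : ℕ} {j j' k : ℕ}
    (h : hw.IsOutStretch n N j k) (h' : hw.IsOutStretch n N j' k) : j = j' := by
  rcases lt_trichotomy j j' with hlt | heq | hgt
  · exact absurd h'.1 (h.2.2.2 j' hlt h'.2.2.1).1
  · exact heq
  · exact absurd h.1 (h'.2.2.2 j hgt h.2.2.1).1

/-- **Existence of an outward stretch**: between a low step `i` and a later high step `k` there is
an outward stretch `i ≤ j₁ < j₂ ≤ k` (the first high step after `i`, the last low step before it).
[cite: AizenmanBurchardDuke1999, Appendix A] -/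
theorem IsSiteInterfaceLoop.exists_isOutStretch {n N : ℕ} (hnN : n ≤ N) {i k : ℕ} (hik : i ≤ k)
    (hi : hw.LowP n i) (hk : hw.HighP N k) :
    ∃ j₁ j₂, i ≤ j₁ ∧ j₂ ≤ k ∧ hw.IsOutStretch n N j₁ j₂ := by
  classical
  have hex : ∃ j, i ≤ j ∧ hw.HighP N j := ⟨k, hik, hk⟩
  set j₂ := Nat.find hex with hj₂
  obtain ⟨hij₂, hj₂spec⟩ : i ≤ j₂ ∧ hw.HighP N j₂ := Nat.find_spec hex
  have hj₂min : ∀ j, i ≤ j → j < j₂ → ¬ hw.HighP N j := fun j hij hj h ↦ Nat.find_min hex hj ⟨hij, h⟩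
  have hj₂k : j₂ ≤ k := Nat.find_min' hex ⟨hik, hk⟩
  have hij₂' : i < j₂ := by
    rcases eq_or_lt_of_le hij₂ with h | h
    · exact absurd (h ▸ hi) (hw.not_lowP_of_highP hnN hj₂spec)
    · exact h
  set P : ℕ → Prop := fun j ↦ i ≤ j ∧ hw.LowP n j with hP
  set j₁ := Nat.findGreatest P (j₂ - 1) with hj₁
  have hj₁le : j₁ ≤ j₂ - 1 := Nat.findGreatest_le _
  have hj₁spec : P j₁ := Nat.findGreatest_spec (P := P) (show i ≤ j₂ - 1 by omega) ⟨le_rfl, hi⟩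
  have hj₁max : ∀ j, j₁ < j → j ≤ j₂ - 1 → ¬ P j := fun j h1 h2 ↦ Nat.findGreatest_is_greatest h1 h2
  refine ⟨j₁, j₂, hj₁spec.1, hj₂k, hj₁spec.2, hj₂spec, by omega, fun j h1 h2 ↦ ⟨?_, ?_⟩⟩
  · intro h; exact hj₁max j h1 (by omega) ⟨by have := hj₁spec.1; omega, h⟩
  · exact hj₂min j (by have := hj₁spec.1; omega) h2

/-- **Existence of an inward stretch**: between a high step `i` and a later low step `k` there is
an inward stretch `i ≤ j₁ < j₂ ≤ k`. [cite: AizenmanBurchardDuke1999, Appendix A] -/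
theorem IsSiteInterfaceLoop.exists_isInStretch {n N : ℕ} (hnN : n ≤ N) {i k : ℕ} (hik : i ≤ k)
    (hi : hw.HighP N i) (hk : hw.LowP n k) :
    ∃ j₁ j₂, i ≤ j₁ ∧ j₂ ≤ k ∧ hw.IsInStretch n N j₁ j₂ := by
  classical
  have hex : ∃ j, i ≤ j ∧ hw.LowP n j := ⟨k, hik, hk⟩
  set j₂ := Nat.find hex with hj₂
  obtain ⟨hij₂, hj₂spec⟩ : i ≤ j₂ ∧ hw.LowP n j₂ := Nat.find_spec hex
  have hj₂min : ∀ j, i ≤ j → j < j₂ → ¬ hw.LowP n j := fun j hij hj h ↦ Nat.find_min hex hj ⟨hij, h⟩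
  have hj₂k : j₂ ≤ k := Nat.find_min' hex ⟨hik, hk⟩
  have hij₂' : i < j₂ := by
    rcases eq_or_lt_of_le hij₂ with h | h
    · exact absurd (h ▸ hj₂spec) (hw.not_lowP_of_highP hnN hi)
    · exact h
  set P : ℕ → Prop := fun j ↦ i ≤ j ∧ hw.HighP N j with hP
  set j₁ := Nat.findGreatest P (j₂ - 1) with hj₁
  have hj₁le : j₁ ≤ j₂ - 1 := Nat.findGreatest_le _
  have hj₁spec : P j₁ := Nat.findGreatest_spec (P := P) (show i ≤ j₂ - 1 by omega) ⟨le_rfl, hi⟩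
  have hj₁max : ∀ j, j₁ < j → j ≤ j₂ - 1 → ¬ P j := fun j h1 h2 ↦ Nat.findGreatest_is_greatest h1 h2
  refine ⟨j₁, j₂, hj₁spec.1, hj₂k, hj₁spec.2, hj₂spec, by omega, fun j h1 h2 ↦ ⟨?_, ?_⟩⟩
  · exact hj₂min j (by have := hj₁spec.1; omega) h2
  · intro h; exact hj₁max j h1 (by omega) ⟨by have := hj₁spec.1; omega, h⟩

/-- **The starting steps of the outward stretches** (residues mod the length). [cite: AizenmanBurchardDuke1999, Appendix A] -/
def IsSiteInterfaceLoop.outStarts (hw : IsSiteInterfaceLoop χ w) (n N : ℕ) : Finset (Fin w.length) := by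
  classical exact Finset.univ.filter fun j ↦ ∃ k, hw.IsOutStretch n N j k

/-- **The starting steps of the inward stretches** (residues mod the length). [cite: AizenmanBurchardDuke1999, Appendix A] -/
def IsSiteInterfaceLoop.inStarts (hw : IsSiteInterfaceLoop χ w) (n N : ℕ) : Finset (Fin w.length) := by
  classical exact Finset.univ.filter fun j ↦ ∃ k, hw.IsInStretch n N j k

/-- **The number of outward crossings of the annulus by the loop.** [cite: AizenmanBurchardDuke1999, Appendix A] -/
def IsSiteInterfaceLoop.outCount (hw : IsSiteInterfaceLoop χ w) (n N : ℕ) : ℕ := (hw.outStarts n N).card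

/-- **The number of inward crossings of the annulus by the loop.** [cite: AizenmanBurchardDuke1999, Appendix A] -/
def IsSiteInterfaceLoop.inCount (hw : IsSiteInterfaceLoop χ w) (n N : ℕ) : ℕ := (hw.inStarts n N).card

/-- Membership in `outStarts`. [folklore] -/
theorem IsSiteInterfaceLoop.mem_outStarts {n N : ℕ} {j : Fin w.length} :
    j ∈ hw.outStarts n N ↔ ∃ k, hw.IsOutStretch n N j k := by
  classical simp [IsSiteInterfaceLoop.outStarts]

/-- Membership in `inStarts`. [folklore] -/
theorem IsSiteInterfaceLoop.mem_inStarts {n N : ℕ} {j : Fin w.length} :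
    j ∈ hw.inStarts n N ↔ ∃ k, hw.IsInStretch n N j k := by
  classical simp [IsSiteInterfaceLoop.inStarts]

/-- The residue of the start of any outward stretch is in `outStarts`. [folklore] -/
theorem IsSiteInterfaceLoop.IsOutStretch.mod_mem_outStarts {n N j k : ℕ} (h : hw.IsOutStretch n N j k) :
    (⟨j % w.length, Nat.mod_lt _ hw.length_pos⟩ : Fin w.length) ∈ hw.outStarts n N := by
  rw [IsSiteInterfaceLoop.mem_outStarts]
  refine ⟨k - (j / w.length) * w.length, ?_⟩
  have hj : j = j % w.length + (j / w.length) * w.length := by rw [Nat.mod_add_div' j w.length]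
  have hsub := h.sub_le
  have := (hj ▸ h : hw.IsOutStretch n N (j % w.length + (j / w.length) * w.length) k)
  -- shift down `j / length` periods
  have key : ∀ c a b, hw.IsOutStretch n N (a + c * w.length) b → c * w.length ≤ b →
      hw.IsOutStretch n N a (b - c * w.length) := by
    intro c
    induction c with
    | zero => intro a b h _; simpa using h
    | succ c ih =>
      intro a b h hb
      have h1 : hw.IsOutStretch n N (a + c * w.length + w.length) b := by
        simpa [Nat.succ_mul, Nat.add_assoc] using h
      have h2 := h1.sub_length (by omega)
      simp only [Nat.add_sub_cancel] at h2
      have h3 := ih a (b - w.length) h2 (by rw [Nat.succ_mul] at hb; omega)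
      rwa [Nat.sub_sub, Nat.add_comm, ← Nat.succ_mul] at h3
  exact key _ _ _ this (by have h1 : j < k := h.2.2.1; have h2 := Nat.div_mul_le_self j w.length; omega)

/-- The residue of the start of any inward stretch is in `inStarts`. [folklore] -/
theorem IsSiteInterfaceLoop.IsInStretch.mod_mem_inStarts {n N j k : ℕ} (h : hw.IsInStretch n N j k) :
    (⟨j % w.length, Nat.mod_lt _ hw.length_pos⟩ : Fin w.length) ∈ hw.inStarts n N := by
  rw [IsSiteInterfaceLoop.mem_inStarts]
  refine ⟨k - (j / w.length) * w.length, ?_⟩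
  have hj : j = j % w.length + (j / w.length) * w.length := by rw [Nat.mod_add_div' j w.length]
  have := (hj ▸ h : hw.IsInStretch n N (j % w.length + (j / w.length) * w.length) k)
  have key : ∀ c a b, hw.IsInStretch n N (a + c * w.length) b → c * w.length ≤ b →
      hw.IsInStretch n N a (b - c * w.length) := by
    intro c
    induction c with
    | zero => intro a b h _; simpa using h
    | succ c ih =>
      intro a b h hb
      have h1 : hw.IsInStretch n N (a + c * w.length + w.length) b := by
        simpa [Nat.succ_mul, Nat.add_assoc] using h
      have h2 := h1.sub_length (by omega)
      simp only [Nat.add_sub_cancel] at h2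
      have h3 := ih a (b - w.length) h2 (by rw [Nat.succ_mul] at hb; omega)
      rwa [Nat.sub_sub, Nat.add_comm, ← Nat.succ_mul] at h3
  exact key _ _ _ this (by have h1 : j < k := h.2.2.1; have h2 := Nat.div_mul_le_self j w.length; omega)

/-- **A loop with a low step and a high step has an outward stretch.** [cite: AizenmanBurchardDuke1999, Appendix A] -/
theorem IsSiteInterfaceLoop.outStarts_nonempty {n N : ℕ} (hnN : n ≤ N) {i k : ℕ} (hi : hw.LowP n i) (hk : hw.HighP N k) :
    (hw.outStarts n N).Nonempty := by
  -- make the high step later than the low one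
  have hk' : hw.HighP N (k + (i + 1) * w.length) := IsSiteInterfaceLoop.highP_add_mul_length.2 hk
  obtain ⟨j₁, j₂, -, -, h⟩ := hw.exists_isOutStretch hnN (i := i) (k := k + (i + 1) * w.length)
    (by have := hw.length_pos; nlinarith) hi hk'
  exact ⟨_, h.mod_mem_outStarts⟩

/-- **A loop with a low step and a high step has an inward stretch.** [cite: AizenmanBurchardDuke1999, Appendix A] -/
theorem IsSiteInterfaceLoop.inStarts_nonempty {n N : ℕ} (hnN : n ≤ N) {i k : ℕ} (hi : hw.HighP N i) (hk : hw.LowP n k) :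
    (hw.inStarts n N).Nonempty := by
  have hk' : hw.LowP n (k + (i + 1) * w.length) := IsSiteInterfaceLoop.lowP_add_mul_length.2 hk
  obtain ⟨j₁, j₂, -, -, h⟩ := hw.exists_isInStretch hnN (i := i) (k := k + (i + 1) * w.length)
    (by have := hw.length_pos; nlinarith) hi hk'
  exact ⟨_, h.mod_mem_inStarts⟩

/-- **Between the ends of two consecutive outward crossings there is an inward one**: if
`(j, k)` is an outward stretch and `j' > j` starts another outward stretch, some inward stretch
starts in `[k, j')`. [cite: AizenmanBurchardDuke1999, Appendix A] -/
theorem IsSiteInterfaceLoop.exists_isInStretch_between {n N : ℕ} (hnN : n ≤ N) {j k j' k' : ℕ}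
    (h : hw.IsOutStretch n N j k) (h' : hw.IsOutStretch n N j' k') (hjj' : j < j') :
    ∃ i₁ i₂, k ≤ i₁ ∧ i₂ ≤ j' ∧ hw.IsInStretch n N i₁ i₂ := by
  have hkj' : k ≤ j' := by
    by_contra hlt; push Not at hlt
    exact (h.2.2.2 j' hjj' hlt).1 h'.1
  exact hw.exists_isInStretch hnN hkj' h.2.1 h'.1

/-- **Between the ends of two consecutive inward crossings there is an outward one.** [cite: AizenmanBurchardDuke1999, Appendix A] -/
theorem IsSiteInterfaceLoop.exists_isOutStretch_between {n N : ℕ} (hnN : n ≤ N) {j k j' k' : ℕ}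
    (h : hw.IsInStretch n N j k) (h' : hw.IsInStretch n N j' k') (hjj' : j < j') :
    ∃ i₁ i₂, k ≤ i₁ ∧ i₂ ≤ j' ∧ hw.IsOutStretch n N i₁ i₂ := by
  have hkj' : k ≤ j' := by
    by_contra hlt; push Not at hlt
    exact (h.2.2.2 j' hjj' hlt).2 h'.1
  exact hw.exists_isOutStretch hnN hkj' h.2.1 h'.1

/-- **No low step on the outer arc.** If `(j, k)` is an outward stretch, `(i, l)` an inward stretch
with `k ≤ i`, and no outward stretch starts strictly between `j` and `i`, then no step in `[k, i]`
is low. [cite: AizenmanBurchardDuke1999, Appendix A] -/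
theorem IsSiteInterfaceLoop.not_lowP_of_between {n N : ℕ} (hnN : n ≤ N) {j k i l : ℕ}
    (h : hw.IsOutStretch n N j k) (hi : hw.IsInStretch n N i l)
    (huniq : ∀ j' k', hw.IsOutStretch n N j' k' → j < j' → j' ≤ i → False) {m : ℕ} (hkm : k ≤ m) (hmi : m ≤ i) :
    ¬ hw.LowP n m := by
  intro hm
  -- an outward stretch between `m` and the high step `i`
  obtain ⟨j₁, j₂, hmj₁, hj₂i, hs⟩ := hw.exists_isOutStretch hnN hmi hm hi.1
  exact huniq j₁ j₂ hs (by have := h.2.2.1; omega) (by have := hs.2.2.1; omega)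

/-- **No high step on the inner arc.** If `(i, l)` is an inward stretch, `(j, k)` an outward
stretch with `l ≤ j`, and no inward stretch starts strictly between `i` and `j`, then no step in
`[l, j]` is high. [cite: AizenmanBurchardDuke1999, Appendix A] -/
theorem IsSiteInterfaceLoop.not_highP_of_between {n N : ℕ} (hnN : n ≤ N) {i l j k : ℕ}
    (hi : hw.IsInStretch n N i l) (h : hw.IsOutStretch n N j k)
    (huniq : ∀ i' l', hw.IsInStretch n N i' l' → i < i' → i' ≤ j → False) {m : ℕ} (hlm : l ≤ m) (hmj : m ≤ j) :
    ¬ hw.HighP N m := by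
  intro hm
  obtain ⟨i₁, i₂, hmi₁, hi₂j, hs⟩ := hw.exists_isInStretch hnN hmj hm h.1
  exact huniq i₁ i₂ hs (by have := hi.2.2.1; omega) (by have := hs.2.2.1; omega)

/-- If only one residue starts an outward stretch, two outward stretches have congruent starts. [folklore] -/
theorem IsSiteInterfaceLoop.modEq_of_outCount_eq_one {n N : ℕ} (hc : hw.outCount n N = 1) {j k j' k' : ℕ}
    (h : hw.IsOutStretch n N j k) (h' : hw.IsOutStretch n N j' k') : j % w.length = j' % w.length := by
  obtain ⟨a, ha⟩ := Finset.card_eq_one.1 hc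
  have h1 := h.mod_mem_outStarts
  have h2 := h'.mod_mem_outStarts
  rw [show hw.outStarts n N = {a} from ha, Finset.mem_singleton] at h1 h2
  have := h1.trans h2.symm
  exact congrArg Fin.val this

/-- If only one residue starts an inward stretch, two inward stretches have congruent starts. [folklore] -/
theorem IsSiteInterfaceLoop.modEq_of_inCount_eq_one {n N : ℕ} (hc : hw.inCount n N = 1) {j k j' k' : ℕ}
    (h : hw.IsInStretch n N j k) (h' : hw.IsInStretch n N j' k') : j % w.length = j' % w.length := by
  obtain ⟨a, ha⟩ := Finset.card_eq_one.1 hc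
  have h1 := h.mod_mem_inStarts
  have h2 := h'.mod_mem_inStarts
  rw [show hw.inStarts n N = {a} from ha, Finset.mem_singleton] at h1 h2
  have := h1.trans h2.symm
  exact congrArg Fin.val this

/-- Window lemma: congruent naturals `a < b` differ by at least the modulus. [folklore] -/
theorem nat_add_le_of_mod_eq_of_lt {a b L : ℕ} (h : a % L = b % L) (hab : a < b) : a + L ≤ b := by
  have ha := Nat.mod_add_div a L
  have hb := Nat.mod_add_div b L
  have h1 : L * (a / L) < L * (b / L) := by omega
  have h2 : a / L + 1 ≤ b / L := Nat.lt_of_mul_lt_mul_left h1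
  have h3 : L * (a / L + 1) ≤ L * (b / L) := Nat.mul_le_mul_left L h2
  rw [Nat.mul_add, Nat.mul_one] at h3
  omega

/-- **The four-arc decomposition of a loop crossing the annulus exactly once each way.** If the
loop has a low and a high step and exactly one outward and one inward crossing
(`outCount = inCount = 1`), there are indices `i₀ ≤ j₁ < j₂ ≤ i₂ < i₁ = i₀ + length` with
`(j₁, j₂)` an outward stretch, `(i₂, i₁)` an inward stretch, no high step in `[i₀, j₁]` (the inner
arc) and no low step in `[j₂, i₂]` (the outer arc). [cite: AizenmanBurchardDuke1999, Appendix A] -/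
theorem IsSiteInterfaceLoop.exists_decomposition {n N : ℕ} (hnN : n ≤ N) (hout : hw.outCount n N = 1)
    (hin : hw.inCount n N = 1) {a b : ℕ} (ha : hw.LowP n a) (hb : hw.HighP N b) :
    ∃ i₀ j₁ j₂ i₂, i₀ ≤ j₁ ∧ j₂ ≤ i₂ ∧ hw.IsOutStretch n N j₁ j₂ ∧ hw.IsInStretch n N i₂ (i₀ + w.length) ∧
      (∀ m, i₀ ≤ m → m ≤ j₁ → ¬ hw.HighP N m) ∧ (∀ m, j₂ ≤ m → m ≤ i₂ → ¬ hw.LowP n m) := by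
  have hL := hw.length_pos
  -- an inward stretch `(i, l)`; base the decomposition at its end `l =: i₀`
  obtain ⟨c, hc⟩ := hw.inStarts_nonempty hnN hb ha
  obtain ⟨l, hil⟩ := hw.mem_inStarts.1 hc
  set i : ℕ := (c : ℕ) with hi_def
  have hil_lt : i < l := hil.2.2.1
  have hil_le : l ≤ i + w.length := hil.sub_le
  -- the outward stretch after `l` (before the high step `i + length`)
  obtain ⟨j₁, j₂, hlj₁, hj₂le, hs⟩ := hw.exists_isOutStretch hnN (i := l) (k := i + w.length) hil_le hil.2.1
    (IsSiteInterfaceLoop.highP_add_length.2 hil.1)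
  have hj₁j₂ : j₁ < j₂ := hs.2.2.1
  -- the inward stretch after `j₂` (before the low step `l + length`)
  obtain ⟨i₂, i₁, hj₂i₂, hi₁le, hs'⟩ := hw.exists_isInStretch hnN (i := j₂) (k := l + w.length) (by omega) hs.2.1
    (IsSiteInterfaceLoop.lowP_add_length.2 hil.2.1)
  have hi₂i₁ : i₂ < i₁ := hs'.2.2.1
  -- `i₂ ≡ i`, `i < i₂ < i + 2 · length`, hence `i₂ = i + length` and then `i₁ = l + length`
  have hmod := hw.modEq_of_inCount_eq_one hin hil hs'
  have hii₂ : i < i₂ := by omega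
  have hge : i + w.length ≤ i₂ := nat_add_le_of_mod_eq_of_lt hmod hii₂
  have hi₂_eq : i₂ = i + w.length := by
    by_contra hne
    have hlt : i + w.length < i₂ := lt_of_le_of_ne hge (Ne.symm hne)
    have hmod' : (i + w.length) % w.length = i₂ % w.length := by rw [Nat.add_mod_right]; exact hmod
    have := nat_add_le_of_mod_eq_of_lt hmod' hlt
    omega
  have hper := hil.add_length
  have hs'' : hw.IsInStretch n N (i + w.length) i₁ := hi₂_eq ▸ hs'
  have hi₁_eq : l + w.length = i₁ := hper.end_unique hs''
  refine ⟨l, j₁, j₂, i₂, hlj₁, hj₂i₂, hs, hi₁_eq ▸ hs', fun m h1 h2 ↦ ?_, fun m h1 h2 ↦ ?_⟩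
  · -- inner arc: between the inward stretch `(i, l)` and the outward stretch `(j₁, j₂)`
    refine hw.not_highP_of_between hnN hil hs (fun i' l' hs₃ h3 h4 ↦ ?_) h1 h2
    -- another inward start `i'` in `(i, j₁]`: congruent to `i`, so `i' ≥ i + length > j₁`
    have hm := hw.modEq_of_inCount_eq_one hin hil hs₃
    have := nat_add_le_of_mod_eq_of_lt hm h3
    omega
  · -- outer arc: between `(j₁, j₂)` and `(i₂, i₁)`
    refine hw.not_lowP_of_between hnN hs hs' (fun j' k'' hs₃ h3 h4 ↦ ?_) h1 h2
    have hm := hw.modEq_of_outCount_eq_one hout hs hs₃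
    have := nat_add_le_of_mod_eq_of_lt hm h3
    -- `i < j₁`: `i` is a high step, `j₁` a low one, and `i ≤ l ≤ j₁`
    have hij₁ : i ≠ j₁ := fun h ↦ hw.not_lowP_of_highP hnN hil.1 (h ▸ hs.1)
    omega

end Steps

/-! ### The cluster-boundary loop of the annulus configuration -/

/-- **The cluster-boundary loop of the annulus configuration.** An interface loop of
`annConfig n N ω` whose winding number is `1` about every site of the open inner ball `Λ̊_n` and
`0` about every site off `Λ_N`: the common boundary of the open cluster of the inner ball and the
closed cluster of the exterior (Smirnov–Werner 2001, §4, Remark 6: the hull of the exploration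
process in the annulus). [cite: SmirnovWernerMRL2001, §4 Remark 6] -/
structure IsKCLoop (n N : ℕ) (ω : SiteConfig (Site 2)) {f₀ : HexVertex} (w : hexGraph.Walk f₀ f₀) : Prop where
  loop : IsSiteInterfaceLoop (annConfig n N ω) w
  wind_ball : ∀ v : Site 2, triNorm v < n → loopWind 1 w (triMeshPoint 1 v) = 1
  wind_out : ∀ v : Site 2, (N : ℤ) < triNorm v → loopWind 1 w (triMeshPoint 1 v) = 0

namespace IsKCLoop

variable {n N : ℕ} {ω : SiteConfig (Site 2)} {f₀ : HexVertex} {w : hexGraph.Walk f₀ f₀} (h : IsKCLoop n N ω w)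
include h

/-- The loop has steps. [folklore] -/
theorem length_pos : 0 < w.length := h.loop.length_pos

/-- **Transport to the ball**: a site joined to a site of `Λ̊_n` by a path of open sites of the
annulus configuration has winding number `1`. [cite: SmirnovWernerMRL2001, §4 Remark 6] -/
theorem loopWind_eq_one {A : Set (Site 2)} (hA : A ⊆ annConfig n N ω) {u v : Site 2}
    (hp : PathIn triGraph A u v) (hu : triNorm u < n) : loopWind 1 w (triMeshPoint 1 v) = 1 := by
  rw [← h.loop.loopWind_eq_of_pathIn one_pos hA hp]; exact h.wind_ball u hu

/-- **Transport to the exterior**: a site joined to a site off `Λ_N` by a path of closed sites has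
winding number `0`. [cite: SmirnovWernerMRL2001, §4 Remark 6] -/
theorem loopWind_eq_zero {A : Set (Site 2)} (hA : A ⊆ (annConfig n N ω)ᶜ) {u v : Site 2}
    (hp : PathIn triGraph A u v) (hu : (N : ℤ) < triNorm u) : loopWind 1 w (triMeshPoint 1 v) = 0 := by
  rw [← h.loop.loopWind_eq_of_pathIn_compl one_pos hA hp]; exact h.wind_out u hu

/-- **Every edge between the two clusters is a step of the loop**: if `a` (open) has winding number
`1`, `b` (closed) is adjacent to it and has winding number `0`, then `a → b` is the crossed edge
of some step. [cite: SmirnovWernerMRL2001, §4 Remark 6] -/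
theorem exists_step {a b : Site 2} (hab : triGraph.Adj a b) (ha : loopWind 1 w (triMeshPoint 1 a) = 1)
    (hb : loopWind 1 w (triMeshPoint 1 b) = 0) (hbω : b ∉ annConfig n N ω) :
    ∃ i < w.length, h.loop.lv i = a ∧ h.loop.rv i = b := by
  by_contra hno
  push Not at hno
  have := h.loop.loopWind_triMeshPoint_eq_of_adj one_pos (Or.inr hab) fun i hi ↦
    ⟨fun hh ↦ hno i hi hh.1.symm hh.2.symm, fun hh ↦ hbω (hh.2 ▸ h.loop.lv_mem hi)⟩
  rw [ha, hb] at this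
  exact one_ne_zero this

end IsKCLoop

/-- **Existence of the cluster-boundary loop** (the construction of
`exists_four_interfaceWalks_of_mem_altFourArm`): let `a` be open, joined by open sites of the
annulus configuration to a site of `Λ̊_n`, and adjacent to a closed site `b` joined by closed sites
to a site off `Λ_N` (`n ≤ N`). Then the interface loop through the edge `a → b` is a
cluster-boundary loop, based so that this edge is its step `0`. [cite: SmirnovWernerMRL2001, §4 Remark 6] -/
theorem exists_isKCLoop {n N : ℕ} (hnN : n ≤ N) {ω : SiteConfig (Site 2)} {a b u z : Site 2}
    (hab : triGraph.Adj a b) {A : Set (Site 2)} (hA : A ⊆ annConfig n N ω) (hpa : PathIn triGraph A u a)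
    (hu : triNorm u < n) {B : Set (Site 2)} (hB : B ⊆ (annConfig n N ω)ᶜ) (hpb : PathIn triGraph B z b)
    (hz : (N : ℤ) < triNorm z) :
    ∃ (f₀ : HexVertex) (w : hexGraph.Walk f₀ f₀) (h : IsKCLoop n N ω w), h.loop.lv 0 = a ∧ h.loop.rv 0 = b := by
  have haω : a ∈ annConfig n N ω := hA hpa.right_mem
  have hbω : b ∉ annConfig n N ω := hB hpb.right_mem
  obtain ⟨f₀, w, hw, hfaces⟩ := exists_isSiteInterfaceLoop_of_adj (annConfig_finite hnN) hab haω hbω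
  have hlen : 0 < w.length := hw.length_pos
  have hlr : hw.lv 0 = a ∧ hw.rv 0 = b := by
    obtain ⟨h', hfaces', -, -⟩ := hw.dart_spec hlen
    exact eq_of_triEdgeFaces_eq h' hab (hfaces'.trans hfaces.symm)
  obtain ⟨ρ, hρ⟩ := exists_polyTrace_subset_closedBall hlen (1 : ℝ)
  -- winding number `0` off `Λ_N`
  have hWout : ∀ v, (N : ℤ) < triNorm v → loopWind 1 w (triMeshPoint 1 v) = 0 := by
    intro v hv
    obtain ⟨k, hk⟩ := exists_nat_gt (2 * ρ)
    obtain ⟨u', hu', hp⟩ := exists_pathIn_triNorm_eq_add (S := (annConfig n N ω)ᶜ)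
      (fun x hx ↦ not_mem_annConfig_of_lt hnN hx) hv k
    have hWu : loopWind 1 w (triMeshPoint 1 u') = 0 := by
      refine loopWind_triMeshPoint_eq_zero_of_lt_norm one_pos hlen hρ ?_
      have h1 := mul_triNorm_le_norm_triEmbed u'
      have h2 : (k : ℝ) ≤ triNorm u' := by
        have : (k : ℤ) ≤ triNorm u' := by rw [hu']; have := triNorm_nonneg v; omega
        exact_mod_cast this
      have h3 : (1 : ℝ) ≤ Real.sqrt 3 := Real.one_le_sqrt.2 (by norm_num)
      have h4 : (0 : ℝ) ≤ triNorm u' := by exact_mod_cast triNorm_nonneg u'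
      nlinarith
    rw [← hWu]
    exact hw.loopWind_eq_of_pathIn_compl one_pos subset_rfl hp
  -- `b` has winding number `0`, hence `a` has winding number `1`
  have hWb : loopWind 1 w (triMeshPoint 1 b) = 0 := by
    rw [← hw.loopWind_eq_of_pathIn_compl one_pos hB hpb]; exact hWout z hz
  have hjump := hw.loopWind_leftPt_sub_loopWind_rightPt one_pos hlen
  rw [IsSiteInterfaceLoop.leftPt, IsSiteInterfaceLoop.rightPt, hlr.1, hlr.2, hWb] at hjump
  have hWa : loopWind 1 w (triMeshPoint 1 a) = 1 := by omega
  -- the ball has winding number `1`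
  have hWu : loopWind 1 w (triMeshPoint 1 u) = 1 := by
    rw [hw.loopWind_eq_of_pathIn one_pos hA hpa]; exact hWa
  have hWball : ∀ v, triNorm v < n → loopWind 1 w (triMeshPoint 1 v) = 1 := by
    intro v hv
    have hv0 : 0 ≤ triNorm v := triNorm_nonneg v
    have hu0 : 0 ≤ triNorm u := triNorm_nonneg u
    rw [← hWu, hw.loopWind_eq_of_pathIn one_pos subset_rfl
        (pathIn_zero_of_triNorm_lt (S := annConfig n N ω) (fun x hx ↦ mem_annConfig_of_lt hx)
          (triNorm u).toNat u (by omega) (by omega)),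
      ← hw.loopWind_eq_of_pathIn one_pos subset_rfl
        (pathIn_zero_of_triNorm_lt (S := annConfig n N ω) (fun x hx ↦ mem_annConfig_of_lt hx)
          (triNorm v).toNat v (by omega) (by omega))]
  exact ⟨f₀, w, ⟨hw, hWball, hWout⟩, hlr.1, hlr.2⟩

end Literature.Probability.Percolation
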